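import Summits.AtomisticToContinuum.FouriersLaw.Theorems.BondHeatUncertaintySubdiffusiveBondHeatSiteEnergyCurrentCovariance

/-!
# Gibbs statics of the pinned chain, II: bounds and integrability of the split site energies

Helper file (`--supports stmt-AtomisticToContinuum-12699`, route `HonestZwanzig`, decl `ParityStatics`).

For the route's symmetrically split site energy
`e_y = p_y²/2 + U(q_y) + ∑_j ([j = y+1] V(q_j - q_y)/2 + [y = j+1] V(q_y - q_j)/2)` of
`pinnedChain ω₂ lam β γ` (written verbatim as in
`Summit.AtomisticToContinuum.FouriersLaw.Theses.HonestZwanzig.ParityStatics`) and the divergence of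
the bond currents `D_y = ∑_b ([y = b+1] j_b - [b = y] j_b)` we record the polynomial bounds
`0 ≤ e_y ≤ (N+2) H`, `|D_y| ≤ N²(3+β)(1+H)²`, continuity, and the integrability of `e_x D_y ρ_T`,
`D_y ρ_T`, `e_x ρ_T`, `e_x p_y² ρ_T` against the Gibbs density `ρ_T = e^{-H/T}` (domination by
`(1+H)⁴ e^{-H/T} ∈ L¹`, `SubdiffusiveBondHeat.pinnedChain_integrable_mul_gibbsDensity_of_le_pow_four`).
All folklore; nothing here closes an item.
-/

noncomputable section

open MeasureTheory

namespace Summit.AtomisticToContinuum.FouriersLaw.Theorems.HonestZwanzig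

open Literature.MathematicalPhysics.KineticTheory.HeatConduction
open Summit.AtomisticToContinuum.FouriersLaw.Theorems.SubdiffusiveBondHeat

variable {N : ℕ}

section Pinned

variable {ω₂ lam β : ℝ}

/-! ### Bounds, continuity and integrability of the split site energy -/

/-- The position part `U(q_y) + ∑_j ([j = y+1] V(q_j - q_y)/2 + [y = j+1] V(q_y - q_j)/2)` of the
split site energy is non-negative (pinned chain, `ω₂, lam, β ≥ 0`). [folklore] -/
theorem pinnedChain_potSiteEnergy_nonneg (hω : 0 ≤ ω₂) (hl : 0 ≤ lam) (hβ : 0 ≤ β) (γ : ℝ) (N : ℕ)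
    (y : Fin N) (q : Fin N → ℝ) :
    0 ≤ (pinnedChain ω₂ lam β γ).U (q y) + ∑ j : Fin N,
        ((if j.val = y.val + 1 then (pinnedChain ω₂ lam β γ).V (q j - q y) / 2 else 0) +
          (if y.val = j.val + 1 then (pinnedChain ω₂ lam β γ).V (q y - q j) / 2 else 0)) := by
  have hU0 : 0 ≤ (pinnedChain ω₂ lam β γ).U (q y) := by
    show 0 ≤ ω₂ * q y ^ 2 / 2 + lam * q y ^ 4 / 4
    positivity
  have hV0 : ∀ r : ℝ, 0 ≤ (pinnedChain ω₂ lam β γ).V r := fun r => by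
    show 0 ≤ r ^ 2 / 2 + β * r ^ 4 / 4
    positivity
  refine add_nonneg hU0 (Finset.sum_nonneg fun j _ => add_nonneg ?_ ?_)
  · split_ifs
    · exact div_nonneg (hV0 _) zero_le_two
    · exact le_rfl
  · split_ifs
    · exact div_nonneg (hV0 _) zero_le_two
    · exact le_rfl

/-- The position part of the split site energy is at most `(N + 1) H` (each half bond and the
pinning energy are bounded by `H`). [folklore] -/
theorem pinnedChain_potSiteEnergy_le (hω : 0 ≤ ω₂) (hl : 0 ≤ lam) (hβ : 0 ≤ β) (γ : ℝ) (N : ℕ)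
    (y : Fin N) (x : PhaseSpace N) :
    (pinnedChain ω₂ lam β γ).U (x.1 y) + ∑ j : Fin N,
        ((if j.val = y.val + 1 then (pinnedChain ω₂ lam β γ).V (x.1 j - x.1 y) / 2 else 0) +
          (if y.val = j.val + 1 then (pinnedChain ω₂ lam β γ).V (x.1 y - x.1 j) / 2 else 0)) ≤
      ((N : ℝ) + 1) * (pinnedChain ω₂ lam β γ).hamiltonian N x := by
  have hH0 : 0 ≤ (pinnedChain ω₂ lam β γ).hamiltonian N x :=
    pinnedChain_hamiltonian_nonneg hω hl hβ γ N x
  have hU : (pinnedChain ω₂ lam β γ).U (x.1 y) ≤ (pinnedChain ω₂ lam β γ).hamiltonian N x :=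
    pinnedChain_U_le_hamiltonian hω hl hβ γ N x y
  have hV0 : ∀ r : ℝ, 0 ≤ (pinnedChain ω₂ lam β γ).V r := fun r => by
    show 0 ≤ r ^ 2 / 2 + β * r ^ 4 / 4
    positivity
  have hb : ∀ j : Fin N, ((if j.val = y.val + 1 then (pinnedChain ω₂ lam β γ).V (x.1 j - x.1 y) / 2
      else 0) + (if y.val = j.val + 1 then (pinnedChain ω₂ lam β γ).V (x.1 y - x.1 j) / 2 else 0)) ≤
      (pinnedChain ω₂ lam β γ).hamiltonian N x := by
    intro j
    have h1 : (if j.val = y.val + 1 then (pinnedChain ω₂ lam β γ).V (x.1 j - x.1 y) / 2 else 0) ≤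
        (pinnedChain ω₂ lam β γ).hamiltonian N x / 2 := by
      split_ifs with hj
      · have := pinnedChain_bond_le_hamiltonian hω hl hβ γ N x (i := y) (j := j) hj
        change (x.1 j - x.1 y) ^ 2 / 2 + β * (x.1 j - x.1 y) ^ 4 / 4 ≤ _ at this
        show ((x.1 j - x.1 y) ^ 2 / 2 + β * (x.1 j - x.1 y) ^ 4 / 4) / 2 ≤ _
        linarith
      · linarith
    have h2 : (if y.val = j.val + 1 then (pinnedChain ω₂ lam β γ).V (x.1 y - x.1 j) / 2 else 0) ≤
        (pinnedChain ω₂ lam β γ).hamiltonian N x / 2 := by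
      split_ifs with hj
      · have := pinnedChain_bond_le_hamiltonian hω hl hβ γ N x (i := j) (j := y) hj
        change (x.1 y - x.1 j) ^ 2 / 2 + β * (x.1 y - x.1 j) ^ 4 / 4 ≤ _ at this
        show ((x.1 y - x.1 j) ^ 2 / 2 + β * (x.1 y - x.1 j) ^ 4 / 4) / 2 ≤ _
        linarith
      · linarith
    linarith
  have hsum : ∑ j : Fin N, ((if j.val = y.val + 1 then (pinnedChain ω₂ lam β γ).V (x.1 j - x.1 y) / 2
      else 0) + (if y.val = j.val + 1 then (pinnedChain ω₂ lam β γ).V (x.1 y - x.1 j) / 2 else 0)) ≤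
      ∑ _j : Fin N, (pinnedChain ω₂ lam β γ).hamiltonian N x := Finset.sum_le_sum fun j _ => hb j
  rw [Finset.sum_const, Finset.card_univ, Fintype.card_fin, nsmul_eq_mul] at hsum
  linarith

/-- `0 ≤ e_y` for the split site energy of the pinned chain. [folklore] -/
theorem pinnedChain_splitSiteEnergy_nonneg (hω : 0 ≤ ω₂) (hl : 0 ≤ lam) (hβ : 0 ≤ β) (γ : ℝ)
    (N : ℕ) (y : Fin N) (x : PhaseSpace N) :
    0 ≤ x.2 y ^ 2 / 2 + (pinnedChain ω₂ lam β γ).U (x.1 y) + ∑ j : Fin N,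
        ((if j.val = y.val + 1 then (pinnedChain ω₂ lam β γ).V (x.1 j - x.1 y) / 2 else 0) +
          (if y.val = j.val + 1 then (pinnedChain ω₂ lam β γ).V (x.1 y - x.1 j) / 2 else 0)) := by
  have := pinnedChain_potSiteEnergy_nonneg hω hl hβ γ N y x.1
  rw [add_assoc]
  exact add_nonneg (by positivity) this

/-- `e_y ≤ (N + 2) H` for the split site energy of the pinned chain. [folklore] -/
theorem pinnedChain_splitSiteEnergy_le (hω : 0 ≤ ω₂) (hl : 0 ≤ lam) (hβ : 0 ≤ β) (γ : ℝ)
    (N : ℕ) (y : Fin N) (x : PhaseSpace N) :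
    x.2 y ^ 2 / 2 + (pinnedChain ω₂ lam β γ).U (x.1 y) + ∑ j : Fin N,
        ((if j.val = y.val + 1 then (pinnedChain ω₂ lam β γ).V (x.1 j - x.1 y) / 2 else 0) +
          (if y.val = j.val + 1 then (pinnedChain ω₂ lam β γ).V (x.1 y - x.1 j) / 2 else 0)) ≤
      ((N : ℝ) + 2) * (pinnedChain ω₂ lam β γ).hamiltonian N x := by
  have h1 := pinnedChain_potSiteEnergy_le hω hl hβ γ N y x
  have h2 : x.2 y ^ 2 ≤ 2 * (pinnedChain ω₂ lam β γ).hamiltonian N x :=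
    pinnedChain_sq_momentum_le hω hl hβ γ N x y
  rw [add_assoc]
  nlinarith

/-- The position part of the split site energy is continuous (pinned chain). [folklore] -/
theorem pinnedChain_continuous_potSiteEnergy (ω₂ lam β γ : ℝ) (N : ℕ) (y : Fin N) :
    Continuous fun q : Fin N → ℝ => (pinnedChain ω₂ lam β γ).U (q y) + ∑ j : Fin N,
        ((if j.val = y.val + 1 then (pinnedChain ω₂ lam β γ).V (q j - q y) / 2 else 0) +
          (if y.val = j.val + 1 then (pinnedChain ω₂ lam β γ).V (q y - q j) / 2 else 0)) := by
  have hUc : Continuous (pinnedChain ω₂ lam β γ).U :=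
    (pinnedChain_contDiff_U ω₂ lam β γ (n := 0)).continuous
  have hVc : Continuous (pinnedChain ω₂ lam β γ).V :=
    (pinnedChain_contDiff_V ω₂ lam β γ (n := 0)).continuous
  refine (hUc.comp (continuous_apply y)).add (continuous_finsetSum _ fun j _ => ?_)
  refine Continuous.add ?_ ?_
  · by_cases hj : j.val = y.val + 1
    · simp only [hj, if_true]
      exact (hVc.comp ((continuous_apply j).sub (continuous_apply y))).div_const 2
    · simp only [hj, if_false]
      exact continuous_const
  · by_cases hj : y.val = j.val + 1
    · simp only [hj, if_true]
      exact (hVc.comp ((continuous_apply y).sub (continuous_apply j))).div_const 2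
    · simp only [hj, if_false]
      exact continuous_const

/-- The split site energy `e_y` is continuous (pinned chain). [folklore] -/
theorem pinnedChain_continuous_splitSiteEnergy (ω₂ lam β γ : ℝ) (N : ℕ) (y : Fin N) :
    Continuous fun x : PhaseSpace N => x.2 y ^ 2 / 2 + (pinnedChain ω₂ lam β γ).U (x.1 y) +
      ∑ j : Fin N, ((if j.val = y.val + 1 then (pinnedChain ω₂ lam β γ).V (x.1 j - x.1 y) / 2 else 0) +
        (if y.val = j.val + 1 then (pinnedChain ω₂ lam β γ).V (x.1 y - x.1 j) / 2 else 0)) := by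
  have h1 : Continuous fun x : PhaseSpace N => x.2 y ^ 2 / 2 := by fun_prop
  have h2 := (pinnedChain_continuous_potSiteEnergy ω₂ lam β γ N y).comp
    (continuous_fst : Continuous fun x : PhaseSpace N => x.1)
  refine (h1.add h2).congr fun x => ?_
  simp only [Pi.add_apply, Function.comp_apply]
  ring

/-! ### The divergence of the bond currents: bound, continuity -/

/-- `|D_y| ≤ N² (3 + β) (1 + H)²` for the divergence of the bond currents of the pinned chain
(`|j_b| ≤ N (3+β)/2 (1+H)²`, at most `2N` terms). [folklore] -/
theorem pinnedChain_abs_bondCurrentDivergence_le (hω : 0 ≤ ω₂) (hl : 0 ≤ lam) (hβ : 0 ≤ β)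
    (γ : ℝ) (N : ℕ) (y : Fin N) (x : PhaseSpace N) :
    |∑ b : Fin N, ((if y.val = b.val + 1 then (pinnedChain ω₂ lam β γ).bondCurrent N b x else 0) -
        (if b = y then (pinnedChain ω₂ lam β γ).bondCurrent N b x else 0))| ≤
      (N : ℝ) ^ 2 * (3 + β) * (1 + (pinnedChain ω₂ lam β γ).hamiltonian N x) ^ 2 := by
  set K := (N : ℝ) * ((3 + β) / 2 * (1 + (pinnedChain ω₂ lam β γ).hamiltonian N x) ^ 2) with hK
  have hK0 : 0 ≤ K := by
    have := pinnedChain_hamiltonian_nonneg hω hl hβ γ N x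
    positivity
  have hj : ∀ b : Fin N, |(pinnedChain ω₂ lam β γ).bondCurrent N b x| ≤ K := fun b =>
    pinnedChain_abs_bondCurrent_le hω hl hβ γ N b x
  have hterm : ∀ b : Fin N,
      |(if y.val = b.val + 1 then (pinnedChain ω₂ lam β γ).bondCurrent N b x else 0) -
        (if b = y then (pinnedChain ω₂ lam β γ).bondCurrent N b x else 0)| ≤ K + K := by
    intro b
    refine (abs_sub _ _).trans (add_le_add ?_ ?_)
    · split_ifs
      · exact hj b
      · rw [abs_zero]; exact hK0
    · split_ifs
      · exact hj b
      · rw [abs_zero]; exact hK0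
  calc |∑ b : Fin N, ((if y.val = b.val + 1 then (pinnedChain ω₂ lam β γ).bondCurrent N b x else 0) -
          (if b = y then (pinnedChain ω₂ lam β γ).bondCurrent N b x else 0))|
      ≤ ∑ b : Fin N, |(if y.val = b.val + 1 then (pinnedChain ω₂ lam β γ).bondCurrent N b x else 0) -
          (if b = y then (pinnedChain ω₂ lam β γ).bondCurrent N b x else 0)| :=
        Finset.abs_sum_le_sum_abs _ _
    _ ≤ ∑ _b : Fin N, (K + K) := Finset.sum_le_sum fun b _ => hterm b
    _ = (N : ℝ) ^ 2 * (3 + β) * (1 + (pinnedChain ω₂ lam β γ).hamiltonian N x) ^ 2 := by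
        rw [Finset.sum_const, Finset.card_univ, Fintype.card_fin, nsmul_eq_mul, hK]
        ring

/-- The divergence of the bond currents of the pinned chain is continuous. [folklore] -/
theorem pinnedChain_continuous_bondCurrentDivergence (ω₂ lam β γ : ℝ) (N : ℕ) (y : Fin N) :
    Continuous fun x : PhaseSpace N => ∑ b : Fin N,
      ((if y.val = b.val + 1 then (pinnedChain ω₂ lam β γ).bondCurrent N b x else 0) -
        (if b = y then (pinnedChain ω₂ lam β γ).bondCurrent N b x else 0)) := by
  refine continuous_finsetSum _ fun b _ => Continuous.sub ?_ ?_
  · by_cases h : y.val = b.val + 1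
    · simp only [h, if_true]; exact pinnedChain_continuous_bondCurrent ω₂ lam β γ N b
    · simp only [h, if_false]; exact continuous_const
  · by_cases h : b = y
    · simp only [h, if_true]; exact pinnedChain_continuous_bondCurrent ω₂ lam β γ N y
    · simp only [h, if_false]; exact continuous_const

/-! ### Integrability against `e^{-H/T}` -/

/-- `D_y e^{-H/T}` is integrable (pinned chain, `ω₂ > 0`, `lam, β ≥ 0`, `T > 0`). [folklore] -/
theorem pinnedChain_integrable_bondCurrentDivergence_mul_gibbsDensity (hω : 0 < ω₂) (hl : 0 ≤ lam)
    (hβ : 0 ≤ β) (γ : ℝ) (N : ℕ) {T : ℝ} (hT : 0 < T) (y : Fin N) :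
    Integrable fun x : PhaseSpace N => (∑ b : Fin N,
      ((if y.val = b.val + 1 then (pinnedChain ω₂ lam β γ).bondCurrent N b x else 0) -
        (if b = y then (pinnedChain ω₂ lam β γ).bondCurrent N b x else 0))) *
      (pinnedChain ω₂ lam β γ).gibbsDensity N T x :=
  pinnedChain_integrable_mul_gibbsDensity_of_le hω hl hβ γ N hT
    (pinnedChain_continuous_bondCurrentDivergence ω₂ lam β γ N y) (C := (N : ℝ) ^ 2 * (3 + β))
    fun x => pinnedChain_abs_bondCurrentDivergence_le hω.le hl hβ γ N y x

/-- `e_x D_y e^{-H/T}` is integrable (cubic in `1 + H`). [folklore] -/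
theorem pinnedChain_integrable_splitSiteEnergy_mul_bondCurrentDivergence_mul_gibbsDensity
    (hω : 0 < ω₂) (hl : 0 ≤ lam) (hβ : 0 ≤ β) (γ : ℝ) (N : ℕ) {T : ℝ} (hT : 0 < T) (x y : Fin N) :
    Integrable fun z : PhaseSpace N => (z.2 x ^ 2 / 2 + (pinnedChain ω₂ lam β γ).U (z.1 x) +
      ∑ j : Fin N, ((if j.val = x.val + 1 then (pinnedChain ω₂ lam β γ).V (z.1 j - z.1 x) / 2 else 0) +
        (if x.val = j.val + 1 then (pinnedChain ω₂ lam β γ).V (z.1 x - z.1 j) / 2 else 0))) *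
      (∑ b : Fin N, ((if y.val = b.val + 1 then (pinnedChain ω₂ lam β γ).bondCurrent N b z else 0) -
        (if b = y then (pinnedChain ω₂ lam β γ).bondCurrent N b z else 0))) *
      (pinnedChain ω₂ lam β γ).gibbsDensity N T z := by
  refine pinnedChain_integrable_mul_gibbsDensity_of_le_pow_four hω hl hβ γ N hT
    ((pinnedChain_continuous_splitSiteEnergy ω₂ lam β γ N x).mul
      (pinnedChain_continuous_bondCurrentDivergence ω₂ lam β γ N y))
    (C := ((N : ℝ) + 2) * ((N : ℝ) ^ 2 * (3 + β))) fun z => ?_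
  have hH0 : 0 ≤ (pinnedChain ω₂ lam β γ).hamiltonian N z :=
    pinnedChain_hamiltonian_nonneg hω.le hl hβ γ N z
  have he0 := pinnedChain_splitSiteEnergy_nonneg hω.le hl hβ γ N x z
  have he1 := pinnedChain_splitSiteEnergy_le hω.le hl hβ γ N x z
  have hD := pinnedChain_abs_bondCurrentDivergence_le hω.le hl hβ γ N y z
  rw [abs_mul, abs_of_nonneg he0]
  set H := (pinnedChain ω₂ lam β γ).hamiltonian N z
  calc _ ≤ (((N : ℝ) + 2) * H) * ((N : ℝ) ^ 2 * (3 + β) * (1 + H) ^ 2) :=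
        mul_le_mul he1 hD (abs_nonneg _) (by positivity)
    _ ≤ ((N : ℝ) + 2) * ((N : ℝ) ^ 2 * (3 + β)) * (1 + H) ^ 4 := by
        have h1 : H ≤ (1 + H) ^ 2 := by nlinarith
        have h2 : 0 ≤ ((N : ℝ) + 2) * ((N : ℝ) ^ 2 * (3 + β)) * (1 + H) ^ 2 := by positivity
        nlinarith

/-- `e_x e^{-H/T}` and `e_x p_y² e^{-H/T}` are integrable. [folklore] -/
theorem pinnedChain_integrable_splitSiteEnergy_mul_gibbsDensity (hω : 0 < ω₂) (hl : 0 ≤ lam)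
    (hβ : 0 ≤ β) (γ : ℝ) (N : ℕ) {T : ℝ} (hT : 0 < T) (x y : Fin N) :
    (Integrable fun z : PhaseSpace N => (z.2 x ^ 2 / 2 + (pinnedChain ω₂ lam β γ).U (z.1 x) +
      ∑ j : Fin N, ((if j.val = x.val + 1 then (pinnedChain ω₂ lam β γ).V (z.1 j - z.1 x) / 2 else 0) +
        (if x.val = j.val + 1 then (pinnedChain ω₂ lam β γ).V (z.1 x - z.1 j) / 2 else 0))) *
      (pinnedChain ω₂ lam β γ).gibbsDensity N T z) ∧
    (Integrable fun z : PhaseSpace N => (z.2 x ^ 2 / 2 + (pinnedChain ω₂ lam β γ).U (z.1 x) +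
      ∑ j : Fin N, ((if j.val = x.val + 1 then (pinnedChain ω₂ lam β γ).V (z.1 j - z.1 x) / 2 else 0) +
        (if x.val = j.val + 1 then (pinnedChain ω₂ lam β γ).V (z.1 x - z.1 j) / 2 else 0))) *
      z.2 y ^ 2 * (pinnedChain ω₂ lam β γ).gibbsDensity N T z) := by
  have hc := pinnedChain_continuous_splitSiteEnergy ω₂ lam β γ N x
  refine ⟨pinnedChain_integrable_mul_gibbsDensity_of_le hω hl hβ γ N hT hc (C := (N : ℝ) + 2)
      fun z => ?_,
    pinnedChain_integrable_mul_gibbsDensity_of_le hω hl hβ γ N hT (hc.mul (by fun_prop))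
      (C := 2 * ((N : ℝ) + 2)) fun z => ?_⟩
  · have hH0 : 0 ≤ (pinnedChain ω₂ lam β γ).hamiltonian N z :=
      pinnedChain_hamiltonian_nonneg hω.le hl hβ γ N z
    rw [abs_of_nonneg (pinnedChain_splitSiteEnergy_nonneg hω.le hl hβ γ N x z)]
    refine (pinnedChain_splitSiteEnergy_le hω.le hl hβ γ N x z).trans ?_
    have : 0 ≤ (N : ℝ) + 2 := by positivity
    nlinarith [mul_nonneg this hH0, mul_nonneg this (mul_nonneg hH0 hH0)]
  · have hH0 : 0 ≤ (pinnedChain ω₂ lam β γ).hamiltonian N z :=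
      pinnedChain_hamiltonian_nonneg hω.le hl hβ γ N z
    have he0 := pinnedChain_splitSiteEnergy_nonneg hω.le hl hβ γ N x z
    have he1 := pinnedChain_splitSiteEnergy_le hω.le hl hβ γ N x z
    have hp2 : z.2 y ^ 2 ≤ 2 * (pinnedChain ω₂ lam β γ).hamiltonian N z :=
      pinnedChain_sq_momentum_le hω.le hl hβ γ N z y
    rw [abs_mul, abs_of_nonneg he0, abs_of_nonneg (sq_nonneg _)]
    set H := (pinnedChain ω₂ lam β γ).hamiltonian N z
    calc _ ≤ (((N : ℝ) + 2) * H) * (2 * H) := mul_le_mul he1 hp2 (sq_nonneg _) (by positivity)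
      _ ≤ 2 * ((N : ℝ) + 2) * (1 + H) ^ 2 := by
          have : 0 ≤ (N : ℝ) + 2 := by positivity
          nlinarith [mul_nonneg this hH0]

end Pinned

end Summit.AtomisticToContinuum.FouriersLaw.Theorems.HonestZwanzig

end
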